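import Mathlib.RingTheory.Invariant.Basic
import Mathlib.RingTheory.Localization.AtPrime.Basic
import Mathlib.GroupTheory.GroupAction.Quotient
import Literature.AlgebraicGeometry.Resolution.UnramifiedLocalHomDense
import HarnessLib

/-!
# Rings between a normal ring and its splitting ring are unramified with trivial residue extension (Abhyankar 1959, Thm. 1.47; [CoP1] Prop. 9.3: "`R₁′ ⊂ R₁ʰ` … `R₁` lies dense in `R₁′`")

Topic: `Literature/AlgebraicGeometry/Resolution`. PROOF side of `CossartPiltant2019ReductionP`
(`ArithmeticalThreefoldsLocal.lean`), input (C4), DECOMPOSITION layer of [CoP1] Prop. 9.3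
(hypothesis `hDec` of `cossartPiltant2019ReductionP_of_cjs_of_stableInertiaHensel`,
`ArithmeticalThreefoldsLocalDescentInertiaHensel.lean`). The printed proof (HAL p. 28) says:

> By (44), `Gˢ(R̃₁/R₁) = Gal(L/Kˢ) = Gal(L/QF(R₁′))`, so that `R₁′ ⊂ R₁ʰ`, where `R₁ʰ` is the
> Henselization of `R₁` ([40], theorem 2 on p.110). In particular, `R₁` lies dense in `R₁′` for
> the `m_{R₁′}`-adic topology.

Here `R₁` is a normal local model of `K`, `R̃₁` its integral closure in the Galois extension `L`,
`R₁′` the local ring of the integral closure of `R₁` in the intermediate field `K′` at the centre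
of the valuation, and (44) says that the splitting (decomposition) group of the centre `𝔪̃` of
`R̃₁` over `R₁` is contained in `Gal(L/K′)`. The commutative algebra behind "dense" is
Abhyankar's theorem on the SPLITTING RING (*Ramification theoretic methods*, Thm. 1.47: "We have
(1) `Rˢ/Mˢ = R/M` and (2) `M Rˢ = Mˢ` (so that `Rˢ` is unramified over `R`)"), which we prove in
the generality of Mathlib's `Algebra.IsInvariant A B G` (a finite group `G` acting on `B` with
`B^G = A`; e.g. `B` the integral closure of a normal domain `A` in a finite Galois extension,
`Algebra.isInvariant_of_isGalois'`) and for every subgroup `H` CONTAINING THE STABILIZER of the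
prime `Q` of `B` (so for every ring between `R` and its splitting ring), with `P = Q ∩ A`
maximal:

* `exists_mem_smul_notMem_smul`, `exists_fixed_notMem_mem_smul`,
  `exists_fixed_sub_one_mem_mem_smul` — PROVED: an `H`-invariant `ε ∈ B` with `ε ≡ 1 mod Q`
  and `ε ∈ g • Q` for every `g ∉ H` (prime avoidance over the finitely many conjugates of `Q`,
  product over `H`, and `B^H/(Q ∩ B^H)` is a field);
* `smul_prod_out_smul`, `prod_out_smul_eq_mul`, `smul_prod_erase_out_smul` — PROVED: the
  coset norm `∏_{q ∈ G/H} q • x` of an `H`-invariant `x` is `G`-invariant and equals `u · x`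
  with `u` the `H`-invariant product of the conjugates `q • x` over the cosets `q ≠ H`;
* `exists_sub_algebraMap_mem_of_stabilizer_le` — PROVED, Thm. 1.47 (1): **trivial residue
  extension**, `A/P → B^H/(Q ∩ B^H)` onto;
* `map_eq_maximalIdeal_of_stabilizer_le` — PROVED, Thm. 1.47 (2): **unramified**,
  `P · (B^H)_{Q ∩ B^H} = 𝔪_{(B^H)_{Q ∩ B^H}}` (no Noetherian hypothesis: Abhyankar's trick
  `a · ∏_{q ≠ H} q a ∈ P` for `a ∈ Q ∩ B^H` outside the other conjugates);
* `exists_sub_algebraMap_mem_maximalIdeal_of_stabilizer_le`,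
  `surjective_quotient_maximalIdeal_pow_of_stabilizer_le` — PROVED: for `A` local, **`A` is
  `𝔪`-adically dense in `(B^H)_{Q ∩ B^H}`** (`A → (B^H)_{Q ∩ B^H} / 𝔪^n` onto for all `n`), by
  `surjective_quotient_maximalIdeal_pow_comp` (`UnramifiedLocalHomDense.lean`).

Everything is PROVED; no named facts, definitions, instances or notation are introduced.

## Sources

* S. S. Abhyankar, *Ramification theoretic methods in algebraic geometry*, Ann. of Math. Studies
  43 (1959), §7, Prop. 1.46, Thm. 1.47 (pp. 32–33). [Abhyankar1959]
* V. Cossart, O. Piltant, J. Algebra 320 (2008) 1051–1082: proof of Prop. 9.3 (HAL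
  hal-00139124, p. 28). [CossartPiltant2008]
* M. Nagata, *Local Rings* (1962), (41.1)–(41.2) and Thm. 2 p. 110 (as cited in [CoP1]). [folklore]
-/

open scoped Pointwise

namespace Literature.AlgebraicGeometry.Resolution

section CosetNorm

variable {G : Type*} [Group G] (H : Subgroup G) {B : Type*} [CommRing B] [MulSemiringAction G B]

/-- A representative of the coset `τ • q` acts on an `H`-invariant element like `τ` composed with
a representative of `q`. [folklore] -/
private theorem out_smul_smul_eq (τ : G) (q : G ⧸ H) {x : B} (hx : ∀ h : H, (h : G) • x = x) :
    (τ • q).out • x = τ • q.out • x := by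
  have h1 : (QuotientGroup.mk (τ • q).out : G ⧸ H) = QuotientGroup.mk (τ * q.out) := by
    rw [QuotientGroup.out_eq', ← MulAction.Quotient.mk_smul_out, smul_eq_mul]
  rw [QuotientGroup.eq] at h1
  have h2 : τ * q.out = (τ • q).out * (((τ • q).out)⁻¹ * (τ * q.out)) := by
    rw [mul_inv_cancel_left]
  calc (τ • q).out • x = (τ • q).out • ((((τ • q).out)⁻¹ * (τ * q.out)) • x) := by
        rw [hx ⟨_, h1⟩]
    _ = ((τ • q).out * (((τ • q).out)⁻¹ * (τ * q.out))) • x := (mul_smul _ _ _).symm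
    _ = (τ * q.out) • x := by rw [← h2]
    _ = τ • q.out • x := mul_smul _ _ _

/-- A representative of a coset `q ≠ H` does not lie in `H`. [folklore] -/
private theorem out_notMem_of_ne_mk_one (q : G ⧸ H) (hq : q ≠ QuotientGroup.mk 1) : q.out ∉ H := by
  intro hmem
  apply hq
  rw [← QuotientGroup.out_eq' q, QuotientGroup.eq, mul_one]
  exact H.inv_mem hmem

/-- The representative of the trivial coset lies in `H`. [folklore] -/
private theorem out_mk_one_mem : (QuotientGroup.mk (1 : G) : G ⧸ H).out ∈ H := by
  obtain ⟨h, hh⟩ := QuotientGroup.mk_out_eq_mul (s := H) (1 : G)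
  rw [hh, one_mul]
  exact h.2

/-- `h • q = H ↔ q = H` in `G/H`, for `h ∈ H`. [folklore] -/
private theorem smul_eq_mk_one_iff (h : H) (q : G ⧸ H) :
    (h : G) • q = QuotientGroup.mk 1 ↔ q = QuotientGroup.mk 1 := by
  have key : ∀ k : H, (k : G) • (QuotientGroup.mk 1 : G ⧸ H) = QuotientGroup.mk 1 := by
    intro k
    rw [MulAction.Quotient.smul_mk, smul_eq_mul, mul_one, QuotientGroup.eq, mul_one]
    exact H.inv_mem k.2
  constructor
  · intro hq
    have : q = (h : G)⁻¹ • (h : G) • q := (inv_smul_smul _ _).symm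
    rw [this, hq]
    exact key ⟨_, H.inv_mem h.2⟩
  · rintro rfl
    exact key h

variable [Fintype (G ⧸ H)]

/-- **The coset norm is invariant**: for `x` fixed by `H`, `τ • ∏_{q ∈ G/H} q.out • x =
∏_{q ∈ G/H} q.out • x` for every `τ ∈ G`. [cite: Abhyankar1959, proof of Thm. 1.47 "`c = N(b) = ∏ g_t(b)`"] -/
theorem smul_prod_out_smul (τ : G) {x : B} (hx : ∀ h : H, (h : G) • x = x) :
    τ • (∏ q : G ⧸ H, q.out • x) = ∏ q : G ⧸ H, q.out • x := by
  rw [Finset.smul_prod']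
  exact Fintype.prod_equiv (MulAction.toPerm τ) _ _
    (fun q => (out_smul_smul_eq H τ q hx).symm)

variable [DecidableEq (G ⧸ H)]

/-- The coset norm of an `H`-invariant `x` is the product of the conjugates `q.out • x` over the
cosets `q ≠ H`, times `x`. [cite: Abhyankar1959, proof of Thm. 1.47] -/
theorem prod_out_smul_eq_mul {x : B} (hx : ∀ h : H, (h : G) • x = x) :
    ∏ q : G ⧸ H, q.out • x =
      (∏ q ∈ Finset.univ.erase (QuotientGroup.mk 1 : G ⧸ H), q.out • x) * x := by
  rw [← Finset.prod_erase_mul Finset.univ (fun q : G ⧸ H => q.out • x)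
    (Finset.mem_univ (QuotientGroup.mk 1 : G ⧸ H)), hx ⟨_, out_mk_one_mem H⟩]

/-- The complementary factor of the coset norm is `H`-invariant. [cite: Abhyankar1959, proof of Thm. 1.47] -/
theorem smul_prod_erase_out_smul (h : H) {x : B} (hx : ∀ h : H, (h : G) • x = x) :
    (h : G) • (∏ q ∈ Finset.univ.erase (QuotientGroup.mk 1 : G ⧸ H), q.out • x) =
      ∏ q ∈ Finset.univ.erase (QuotientGroup.mk 1 : G ⧸ H), q.out • x := by
  rw [Finset.smul_prod']
  refine Finset.prod_equiv (MulAction.toPerm (h : G)) (fun q => ?_) (fun q _ => ?_)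
  · simp only [Finset.mem_erase, Finset.mem_univ, and_true, MulAction.toPerm_apply, ne_eq,
      smul_eq_mk_one_iff]
  · rw [MulAction.toPerm_apply, out_smul_smul_eq H _ q hx]

end CosetNorm

section SplittingRing

variable {A B : Type*} [CommRing A] [CommRing B] [Algebra A B]
  {G : Type*} [Group G] [Finite G] [MulSemiringAction G B]
  (H : Subgroup G) (Q : Ideal B) [Q.IsPrime] (hH : MulAction.stabilizer G Q ≤ H)

include hH

/-- **Prime avoidance among the conjugates**: if `H` contains the stabilizer of the prime `Q`,
some `b ∈ B` lies in every conjugate `g • Q`, `g ∉ H`, and in no conjugate `h • Q`, `h ∈ H`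
(the conjugates `g • Q`, `g ∉ H`, are distinct from the `h • Q`, `h ∈ H`).
[cite: Abhyankar1959, Prop. 1.46 and §1.3] -/
theorem exists_mem_smul_notMem_smul :
    ∃ b : B, (∀ g : G, g ∉ H → b ∈ g • Q) ∧ ∀ h : G, h ∈ H → b ∉ h • Q := by
  classical
  cases nonempty_fintype G
  let s : Finset G := Finset.univ.filter (fun g => g ∉ H)
  let t : Finset G := Finset.univ.filter (fun g => g ∈ H)
  let I : Ideal B := s.inf (fun g => g • Q)
  have hnot : ¬ ((I : Set B) ⊆ ⋃ h ∈ (↑t : Set G), ((h • Q : Ideal B) : Set B)) := by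
    intro hsub
    obtain ⟨h, ht, hle⟩ := (Ideal.subset_union_prime (1 : G) (1 : G)
      (fun g _ _ _ => (inferInstance : (g • Q).IsPrime))).mp hsub
    obtain ⟨g, hs, hgle⟩ :=
      (Ideal.IsPrime.inf_le' (inferInstance : (h • Q).IsPrime)).mp hle
    have hgH : g ∉ H := (Finset.mem_filter.mp hs).2
    have hhH : h ∈ H := (Finset.mem_filter.mp ht).2
    have h2 : (h⁻¹ * g) • Q ≤ Q := by
      have := (Ideal.pointwise_smul_le_pointwise_smul_iff (a := h⁻¹)).mpr hgle
      rwa [smul_smul, smul_smul, inv_mul_cancel, one_smul] at this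
    have h3 : (h⁻¹ * g) • Q = Q := smul_eq_of_smul_le h2
    have h4 : h⁻¹ * g ∈ MulAction.stabilizer G Q := h3
    have h5 : h * (h⁻¹ * g) ∈ H := H.mul_mem hhH (hH h4)
    rw [mul_inv_cancel_left] at h5
    exact hgH h5
  obtain ⟨b, hbI, hb⟩ := Set.not_subset.mp hnot
  refine ⟨b, fun g hg => ?_, fun h hh hb' => hb ?_⟩
  · exact (Finset.inf_le (Finset.mem_filter.mpr ⟨Finset.mem_univ g, hg⟩) : I ≤ g • Q) hbI
  · exact Set.mem_biUnion (Finset.mem_coe.mpr (Finset.mem_filter.mpr ⟨Finset.mem_univ h, hh⟩))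
      hb'

/-- An `H`-INVARIANT element outside `Q` lying in every conjugate `g • Q`, `g ∉ H`: the product
over `H` of the translates of the element of `exists_mem_smul_notMem_smul`.
[cite: Abhyankar1959, proof of Prop. 1.46] -/
theorem exists_fixed_notMem_mem_smul :
    ∃ c : B, (∀ h : H, (h : G) • c = c) ∧ c ∉ Q ∧ ∀ g : G, g ∉ H → c ∈ g • Q := by
  classical
  cases nonempty_fintype G
  obtain ⟨b, hbg, hbh⟩ := exists_mem_smul_notMem_smul H Q hH
  refine ⟨∏ h : H, (h : G) • b, fun h' => ?_, ?_, fun g hg => ?_⟩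
  · rw [Finset.smul_prod']
    simp_rw [smul_smul]
    exact Fintype.prod_equiv (Equiv.mulLeft h') _ _ (fun h => by simp)
  · rw [Ideal.IsPrime.prod_mem_iff]
    rintro ⟨h, -, hh⟩
    exact hbh _ (H.inv_mem h.2) (Ideal.mem_inv_pointwise_smul_iff.mpr hh)
  · have := Finset.prod_erase_mul Finset.univ (fun h : H => (h : G) • b)
      (Finset.mem_univ (1 : H))
    rw [← this, OneMemClass.coe_one, one_smul]
    exact Ideal.mul_mem_left _ _ (hbg g hg)

variable [SMulCommClass G A B] [Algebra.IsInvariant A B G] (P : Ideal A)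

include P

omit hH in
/-- `Q ∩ B^H` is a maximal ideal of `B^H` when `Q ∩ A` is maximal (`B` is integral over `A`).
[cite: Abhyankar1959, §7 (the local rings lying above `R`)] -/
theorem isMaximal_under_fixedPoints [P.IsMaximal] [Q.LiesOver P] :
    (Q.under (FixedPoints.subalgebra A B H)).IsMaximal := by
  haveI : Algebra.IsIntegral A B := Algebra.IsInvariant.isIntegral A B G
  haveI : Algebra.IsIntegral A (FixedPoints.subalgebra A B H) :=
    Algebra.IsIntegral.of_injective (FixedPoints.subalgebra A B H).val Subtype.val_injective
  refine Ideal.isMaximal_of_isIntegral_of_isMaximal_comap (R := A)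
    (Q.under (FixedPoints.subalgebra A B H)) ?_
  have : (Q.under (FixedPoints.subalgebra A B H)).comap
      (algebraMap A (FixedPoints.subalgebra A B H)) = P := by
    rw [← Ideal.under_def, Ideal.under_under, ← Q.over_def P]
  rw [this]
  infer_instance

/-- **The element `ε`**: an `H`-invariant `ε ∈ B` with `ε ≡ 1 mod Q` and `ε ∈ g • Q` for all
`g ∉ H` (normalize the element of `exists_fixed_notMem_mem_smul` by its inverse in the FIELD
`B^H/(Q ∩ B^H)`). [cite: Abhyankar1959, proof of Thm. 1.47 ("there exists `b ∈ Tˢ` such that `b ≡ a mod Nˢ` and `1 mod Nᵢˢ`")] -/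
theorem exists_fixed_sub_one_mem_mem_smul [P.IsMaximal] [Q.LiesOver P] :
    ∃ ε : FixedPoints.subalgebra A B H,
      ((ε : B) - 1 ∈ Q) ∧ ∀ g : G, g ∉ H → (ε : B) ∈ g • Q := by
  obtain ⟨c, hcH, hcQ, hcg⟩ := exists_fixed_notMem_mem_smul H Q hH
  let c' : FixedPoints.subalgebra A B H := ⟨c, hcH⟩
  have hmax := isMaximal_under_fixedPoints H Q P
  have hc' : c' ∉ Q.under (FixedPoints.subalgebra A B H) := hcQ
  obtain ⟨d, i, hi, hdi⟩ := hmax.exists_inv hc'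
  refine ⟨d * c', ?_, fun g hg => ?_⟩
  · have : ((d * c' : FixedPoints.subalgebra A B H) : B) - 1 =
        -((i : FixedPoints.subalgebra A B H) : B) := by
      rw [← sub_eq_of_eq_add' hdi.symm]
      push_cast
      ring
    rw [this]
    exact Q.neg_mem_iff.mpr hi
  · exact Ideal.mul_mem_left _ _ (hcg g hg)

omit hH in
/-- **Abhyankar's observation** (proof of Thm. 1.47 (2)): an `H`-invariant `a ∈ Q` with
`g • a ∉ Q` for all `g ∉ H` lies in `P · (B^H)_{Q ∩ B^H}`: its coset norm `u · a` lies in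
`B^G ∩ Q = P` and the complementary factor `u` (a product of conjugates `g • a ∉ Q`, `g ∉ H`) is
a unit at `Q ∩ B^H`.
[cite: Abhyankar1959, proof of Thm. 1.47 (2) ("`a a* ∈ M ∩ Y₁`, for instance let `a* = ∏_{t=2}^q g_t(a)`")] -/
theorem algebraMap_mem_map_of_forall_smul_notMem [Q.LiesOver P] :
    ∀ a : FixedPoints.subalgebra A B H, (a : B) ∈ Q → (∀ g : G, g ∉ H → g • (a : B) ∉ Q) →
    algebraMap (FixedPoints.subalgebra A B H)
        (Localization.AtPrime (Q.under (FixedPoints.subalgebra A B H))) a ∈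
      P.map (algebraMap A (Localization.AtPrime (Q.under (FixedPoints.subalgebra A B H)))) := by
  classical
  set B' := FixedPoints.subalgebra A B H
  set Q' := Q.under B'
  set L := Localization.AtPrime Q'
  intro a haQ ha
  haveI : Fintype (G ⧸ H) := Fintype.ofFinite _
  have hx : ∀ h : H, (h : G) • (a : B) = a := a.2
  set N := ∏ q : G ⧸ H, q.out • (a : B) with hN
  have hNfix : ∀ g : G, g • N = N := fun g => smul_prod_out_smul H g hx
  obtain ⟨p, hp⟩ := Algebra.IsInvariant.isInvariant (A := A) (G := G) N hNfix
  set u := ∏ q ∈ Finset.univ.erase (QuotientGroup.mk 1 : G ⧸ H), q.out • (a : B) with hu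
  have hNu : N = u * a := prod_out_smul_eq_mul H hx
  have huH : ∀ h : H, (h : G) • u = u := fun h => smul_prod_erase_out_smul H h hx
  have huQ : u ∉ Q := by
    rw [hu, Ideal.IsPrime.prod_mem_iff]
    rintro ⟨q, hq1, hq⟩
    exact ha q.out (out_notMem_of_ne_mk_one H q (Finset.ne_of_mem_erase hq1)) hq
  have hNQ : N ∈ Q := by
    rw [hNu]
    exact Ideal.mul_mem_left _ _ haQ
  have hpP : p ∈ P := by
    rw [Q.over_def P, Ideal.under_def, Ideal.mem_comap, hp]
    exact hNQ
  let u' : B' := ⟨u, huH⟩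
  have hau : u' * a = algebraMap A B' p := by
    apply Subtype.ext
    change u * (a : B) = ((algebraMap A B' p : B') : B)
    rw [Subalgebra.coe_algebraMap, hp, hNu]
  have hu'Q : u' ∈ Q'.primeCompl := fun h => huQ h
  have hunit : IsUnit (algebraMap B' L u') := IsLocalization.map_units L ⟨u', hu'Q⟩
  have key : algebraMap B' L a = ↑(hunit.unit⁻¹) * algebraMap A L p := by
    rw [IsScalarTower.algebraMap_apply A B' L, ← hau, map_mul, ← mul_assoc,
      IsUnit.val_inv_mul, one_mul]
  rw [key]
  exact Ideal.mul_mem_left _ _ (Ideal.mem_map_of_mem _ hpP)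

/-- **Abhyankar 1959, Thm. 1.47 (2), for every ring between `R` and its splitting ring:
UNRAMIFIED.** If `H` contains the stabilizer of the prime `Q` of `B` (`B^G = A`, `G` finite) and
`P = Q ∩ A` is maximal, then `P · (B^H)_{Q ∩ B^H}` is the maximal ideal of `(B^H)_{Q ∩ B^H}`
("`M Rˢ = Mˢ`"; in [CoP1] Prop. 9.3: `m_{R₁} R₁′ = m_{R₁′}` for `R₁′` the model of `K′ ⊆ Kˢ` above
`R₁`). No Noetherian hypothesis is needed.
[cite: Abhyankar1959, Thm. 1.47 (2)] [cite: CossartPiltant2008, proof of Prop. 9.3 (HAL p. 28)] -/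
theorem map_eq_maximalIdeal_of_stabilizer_le [P.IsMaximal] [Q.LiesOver P] :
    P.map (algebraMap A (Localization.AtPrime (Q.under (FixedPoints.subalgebra A B H)))) =
      IsLocalRing.maximalIdeal (Localization.AtPrime (Q.under (FixedPoints.subalgebra A B H))) := by
  classical
  have hA := algebraMap_mem_map_of_forall_smul_notMem H Q P
  have hε := exists_fixed_sub_one_mem_mem_smul H Q hH P
  set B' := FixedPoints.subalgebra A B H
  set Q' := Q.under B'
  set L := Localization.AtPrime Q'
  obtain ⟨ε, hε1, hεg⟩ := hε
  apply le_antisymm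
  · rw [IsScalarTower.algebraMap_eq A B' L, ← Ideal.map_map,
      ← Localization.AtPrime.map_eq_maximalIdeal]
    apply Ideal.map_mono
    rw [Ideal.map_le_iff_le_comap, ← Ideal.under_def, Ideal.under_under, ← Q.over_def P]
  · rw [← Localization.AtPrime.map_eq_maximalIdeal, Ideal.map_le_iff_le_comap]
    intro f hf
    rw [Ideal.mem_comap]
    have h1Q : (1 : B) ∉ Q := (Ideal.ne_top_iff_one Q).mp Ideal.IsPrime.ne_top'
    have hεQ : (ε : B) ∉ Q := fun h => by
      have : (1 : B) = ε - (ε - 1) := by ring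
      exact h1Q (this ▸ Q.sub_mem h hε1)
    have hεQ' : ε ∈ Q'.primeCompl := fun h => hεQ h
    have hgε : ∀ g : G, g ∉ H → g • (ε : B) ∈ Q := fun g hg =>
      Ideal.mem_inv_pointwise_smul_iff.mp (hεg g⁻¹ (fun h => hg (by simpa using H.inv_mem h)))
    have hfQ : ((f : B') : B) ∈ Q := hf
    -- `e := 1 - ε` and `a := f ε + (1 - ε)` both satisfy Abhyankar's observation
    have he : algebraMap B' L (1 - ε) ∈ P.map (algebraMap A L) := by
      refine hA (1 - ε) ?_ (fun g hg hmem => ?_)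
      · have : (((1 - ε : B') : B)) = -((ε : B) - 1) := by push_cast; ring
        rw [this]
        exact Q.neg_mem_iff.mpr hε1
      · have h1 : g • (((1 - ε : B') : B)) = 1 - g • (ε : B) := by
          push_cast
          rw [smul_sub, smul_one]
        rw [h1] at hmem
        have : (1 : B) = (1 - g • (ε : B)) + g • (ε : B) := by ring
        exact h1Q (this ▸ Q.add_mem hmem (hgε g hg))
    have ha : algebraMap B' L (f * ε + (1 - ε)) ∈ P.map (algebraMap A L) := by
      refine hA _ ?_ (fun g hg hmem => ?_)
      · have : (((f * ε + (1 - ε) : B') : B)) = (f : B) * ε - ((ε : B) - 1) := by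
          push_cast; ring
        rw [this]
        exact Q.sub_mem (Ideal.mul_mem_right _ _ hfQ) hε1
      · have h1 : g • (((f * ε + (1 - ε) : B') : B)) =
            (g • (f : B) - 1) * (g • (ε : B)) + 1 := by
          push_cast
          rw [smul_add, smul_sub, smul_mul', smul_one]
          ring
        rw [h1] at hmem
        have : (1 : B) = ((g • (f : B) - 1) * (g • (ε : B)) + 1) -
            (g • (f : B) - 1) * (g • (ε : B)) := by ring
        exact h1Q (this ▸ Q.sub_mem hmem (Ideal.mul_mem_left _ _ (hgε g hg)))
    have hfe : algebraMap B' L f * algebraMap B' L ε ∈ P.map (algebraMap A L) := by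
      have : f * ε = (f * ε + (1 - ε)) - (1 - ε) := by ring
      rw [← map_mul, this, map_sub]
      exact Ideal.sub_mem _ ha he
    have hunit : IsUnit (algebraMap B' L ε) := IsLocalization.map_units L ⟨ε, hεQ'⟩
    have := Ideal.mul_mem_right (↑(hunit.unit⁻¹) : L) _ hfe
    rwa [mul_assoc, IsUnit.mul_val_inv, mul_one] at this

/-- **Abhyankar 1959, Thm. 1.47 (1), for every ring between `R` and its splitting ring: TRIVIAL
RESIDUE EXTENSION.** If `H` contains the stabilizer of the prime `Q` of `B` (`B^G = A`, `G`
finite) and `P = Q ∩ A` is maximal, every `H`-invariant `x ∈ B` is congruent modulo `Q` to an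
element of `A` ("`Rˢ/Mˢ = R/M`"; in [CoP1] Prop. 9.3: `κ(R₁′) = κ(R₁)`): the coset norm of
`x′ := 1 + ε (x − 1)` is `≡ x mod Q` and `G`-invariant.
[cite: Abhyankar1959, Thm. 1.47 (1)] [cite: CossartPiltant2008, proof of Prop. 9.3 (HAL p. 28)] -/
theorem exists_sub_algebraMap_mem_of_stabilizer_le [P.IsMaximal] [Q.LiesOver P] (x : B) (hx : ∀ h : H, (h : G) • x = x) :
    ∃ a : A, x - algebraMap A B a ∈ Q := by
  classical
  haveI : Fintype (G ⧸ H) := Fintype.ofFinite _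
  obtain ⟨ε, hε1, hεg⟩ := exists_fixed_sub_one_mem_mem_smul H Q hH P
  have hgε : ∀ g : G, g ∉ H → g • (ε : B) ∈ Q := fun g hg =>
    Ideal.mem_inv_pointwise_smul_iff.mp (hεg g⁻¹ (fun h => hg (by simpa using H.inv_mem h)))
  set x' : B := 1 + (ε : B) * (x - 1) with hx'def
  have hx' : ∀ h : H, (h : G) • x' = x' := fun h => by
    have hεh : (h : G) • (ε : B) = ε := ε.2 h
    rw [hx'def, smul_add, smul_one, smul_mul', smul_sub, smul_one, hx h, hεh]
  have hx'x : x' - x ∈ Q := by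
    have : x' - x = (x - 1) * ((ε : B) - 1) := by rw [hx'def]; ring
    rw [this]
    exact Ideal.mul_mem_left _ _ hε1
  have hgx' : ∀ g : G, g ∉ H → g • x' - 1 ∈ Q := fun g hg => by
    have : g • x' - 1 = (g • x - 1) * (g • (ε : B)) := by
      rw [hx'def, smul_add, smul_one, smul_mul', smul_sub, smul_one]; ring
    rw [this]
    exact Ideal.mul_mem_left _ _ (hgε g hg)
  set N := ∏ q : G ⧸ H, q.out • x' with hN
  have hNfix : ∀ g : G, g • N = N := fun g => smul_prod_out_smul H g hx'
  obtain ⟨a, ha⟩ := Algebra.IsInvariant.isInvariant (A := A) (G := G) N hNfix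
  refine ⟨a, ?_⟩
  have hNu : N = (∏ q ∈ Finset.univ.erase (QuotientGroup.mk 1 : G ⧸ H), q.out • x') * x' :=
    prod_out_smul_eq_mul H hx'
  -- compute modulo `Q`
  rw [← Ideal.Quotient.eq, ha, hNu, map_mul, map_prod]
  have h1 : ∀ q ∈ Finset.univ.erase (QuotientGroup.mk 1 : G ⧸ H),
      Ideal.Quotient.mk Q (q.out • x') = 1 := by
    intro q hq
    rw [eq_comm, ← map_one (Ideal.Quotient.mk Q), Ideal.Quotient.eq, ← Q.neg_mem_iff, neg_sub]
    exact hgx' q.out (out_notMem_of_ne_mk_one H q (Finset.ne_of_mem_erase hq))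
  rw [Finset.prod_eq_one h1, one_mul]
  exact (Ideal.Quotient.eq.mpr hx'x).symm

end SplittingRing

section Local

variable {A B : Type*} [CommRing A] [IsLocalRing A] [CommRing B] [Algebra A B]
  {G : Type*} [Group G] [Finite G] [MulSemiringAction G B] [SMulCommClass G A B]
  [Algebra.IsInvariant A B G]
  (H : Subgroup G) (Q : Ideal B) [Q.IsPrime] [Q.LiesOver (IsLocalRing.maximalIdeal A)]
  (hH : MulAction.stabilizer G Q ≤ H)

include hH

/-- For `A` LOCAL with `Q ∩ A = 𝔪_A`: every element of `(B^H)_{Q ∩ B^H}` is congruent to an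
element of `A` modulo the maximal ideal. [cite: Abhyankar1959, Thm. 1.47 (1)] -/
theorem exists_sub_algebraMap_mem_maximalIdeal_of_stabilizer_le :
    ∀ b : Localization.AtPrime (Q.under (FixedPoints.subalgebra A B H)),
    ∃ a : A, b - algebraMap A _ a ∈
      IsLocalRing.maximalIdeal (Localization.AtPrime (Q.under (FixedPoints.subalgebra A B H))) := by
  have hmax := isMaximal_under_fixedPoints H Q (IsLocalRing.maximalIdeal A)
  have hres := exists_sub_algebraMap_mem_of_stabilizer_le H Q hH (IsLocalRing.maximalIdeal A)
  set B' := FixedPoints.subalgebra A B H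
  set Q' := Q.under B'
  set L := Localization.AtPrime Q'
  intro b
  obtain ⟨⟨x, s⟩, hb⟩ := IsLocalization.mk'_surjective Q'.primeCompl b
  simp only at hb
  subst hb
  obtain ⟨s', i, hi, hsi⟩ := hmax.exists_inv (show (s : B') ∉ Q' from s.2)
  obtain ⟨a, ha⟩ := hres ((x * s' : B') : B) (x * s').2
  refine ⟨a, ?_⟩
  have hspec : IsLocalization.mk' L x s * algebraMap B' L (s : B') = algebraMap B' L x :=
    IsLocalization.mk'_spec L x s
  have hi' : algebraMap B' L i = 1 - algebraMap B' L s' * algebraMap B' L (s : B') := by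
    rw [← map_mul, ← map_one (algebraMap B' L), ← map_sub, ← hsi, add_sub_cancel_left]
  have h1 : IsLocalization.mk' L x s - algebraMap A L a =
      IsLocalization.mk' L x s * algebraMap B' L i +
        algebraMap B' L (x * s' - algebraMap A B' a) := by
    rw [map_sub, ← IsScalarTower.algebraMap_apply, map_mul, hi']
    linear_combination (algebraMap B' L s') * hspec
  rw [h1, ← Localization.AtPrime.map_eq_maximalIdeal]
  refine Ideal.add_mem _ (Ideal.mul_mem_left _ _ (Ideal.mem_map_of_mem _ hi))
    (Ideal.mem_map_of_mem _ ?_)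
  change (((x * s' - algebraMap A B' a : B') : B)) ∈ Q
  rw [AddSubgroupClass.coe_sub, Subalgebra.coe_algebraMap]
  exact ha

/-- **[CoP1] Prop. 9.3: "`R₁` lies dense in `R₁′` for the `m_{R₁′}`-adic topology."** For `A`
local with `B^G = A` (`G` finite), `Q` a prime of `B` above `𝔪_A` whose stabilizer is contained
in `H`: the map `A → (B^H)_{Q ∩ B^H} / 𝔪^n` is onto for every `n` — the local ring of `B^H` at
`Q ∩ B^H` is unramified over `A` with trivial residue extension
(`map_eq_maximalIdeal_of_stabilizer_le`, `exists_sub_algebraMap_mem_maximalIdeal_of_stabilizer_le`)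
and `surjective_quotient_maximalIdeal_pow_comp` applies.
[cite: CossartPiltant2008, proof of Prop. 9.3 (HAL p. 28)] [cite: Abhyankar1959, Thm. 1.47] -/
theorem surjective_quotient_maximalIdeal_pow_of_stabilizer_le (n : ℕ) :
    Function.Surjective ((Ideal.Quotient.mk (IsLocalRing.maximalIdeal
      (Localization.AtPrime (Q.under (FixedPoints.subalgebra A B H))) ^ n)).comp
        (algebraMap A (Localization.AtPrime (Q.under (FixedPoints.subalgebra A B H))))) :=
  surjective_quotient_maximalIdeal_pow_comp (algebraMap A _)
    (map_eq_maximalIdeal_of_stabilizer_le H Q hH (IsLocalRing.maximalIdeal A))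
    (exists_sub_algebraMap_mem_maximalIdeal_of_stabilizer_le H Q hH) n

end Local

end Literature.AlgebraicGeometry.Resolution

/-! ## The same statements for an arbitrary localization at `Q ∩ B^H`

The consumer's local rings are subrings of an ambient field carrying an `IsLocalization.AtPrime`
structure (`locAtCentre`, `LocalBlowup.lean`), not the type `Localization.AtPrime`; the density
statements transport along `IsLocalization.algEquiv`. -/

namespace Literature.AlgebraicGeometry.Resolution

section AnyLocalization

variable {A B : Type*} [CommRing A] [IsLocalRing A] [CommRing B] [Algebra A B]
  {G : Type*} [Group G] [Finite G] [MulSemiringAction G B] [SMulCommClass G A B]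
  [Algebra.IsInvariant A B G]
  (H : Subgroup G) (Q : Ideal B) [Q.IsPrime] [Q.LiesOver (IsLocalRing.maximalIdeal A)]
  (hH : MulAction.stabilizer G Q ≤ H)
  (L : Type*) [CommRing L] [IsLocalRing L] [Algebra (FixedPoints.subalgebra A B H) L]
  [IsLocalization.AtPrime L (Q.under (FixedPoints.subalgebra A B H))]

include hH

/-- `map_eq_maximalIdeal_of_stabilizer_le` for ANY localization `L` of `B^H` at `Q ∩ B^H` (`A`
local, `Q ∩ A = 𝔪_A`): `𝔪_A L = 𝔪_L`. [cite: Abhyankar1959, Thm. 1.47 (2)] -/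
theorem map_comp_eq_maximalIdeal_of_stabilizer_le :
    (IsLocalRing.maximalIdeal A).map
        ((algebraMap (FixedPoints.subalgebra A B H) L).comp
          (algebraMap A (FixedPoints.subalgebra A B H))) =
      IsLocalRing.maximalIdeal L := by
  let e : Localization.AtPrime (Q.under (FixedPoints.subalgebra A B H))
      ≃ₐ[FixedPoints.subalgebra A B H] L :=
    IsLocalization.algEquiv (Q.under (FixedPoints.subalgebra A B H)).primeCompl _ _
  have hcomp : (algebraMap (FixedPoints.subalgebra A B H) L).comp
        (algebraMap A (FixedPoints.subalgebra A B H)) =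
      (e : Localization.AtPrime (Q.under (FixedPoints.subalgebra A B H)) →+* L).comp
        (algebraMap A (Localization.AtPrime (Q.under (FixedPoints.subalgebra A B H)))) := by
    ext a
    rw [RingHom.comp_apply, RingHom.comp_apply, IsScalarTower.algebraMap_apply A
      (FixedPoints.subalgebra A B H) (Localization.AtPrime (Q.under (FixedPoints.subalgebra A B H))),
      RingHom.coe_coe, AlgEquiv.commutes]
  rw [hcomp, ← Ideal.map_map, map_eq_maximalIdeal_of_stabilizer_le H Q hH
    (IsLocalRing.maximalIdeal A)]
  exact IsLocalRing.map_ringEquiv_maximalIdeal e.toRingEquiv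

/-- `exists_sub_algebraMap_mem_maximalIdeal_of_stabilizer_le` for any localization `L`: every
element of `L` is congruent to an element of `A` modulo `𝔪_L`. [cite: Abhyankar1959, Thm. 1.47 (1)] -/
theorem exists_sub_algebraMap_comp_mem_maximalIdeal_of_stabilizer_le (b : L) :
    ∃ a : A, b - (algebraMap (FixedPoints.subalgebra A B H) L) (algebraMap A _ a) ∈
      IsLocalRing.maximalIdeal L := by
  let e : Localization.AtPrime (Q.under (FixedPoints.subalgebra A B H))
      ≃ₐ[FixedPoints.subalgebra A B H] L :=
    IsLocalization.algEquiv (Q.under (FixedPoints.subalgebra A B H)).primeCompl _ _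
  obtain ⟨b₁, rfl⟩ := e.surjective b
  obtain ⟨a, ha⟩ := exists_sub_algebraMap_mem_maximalIdeal_of_stabilizer_le H Q hH b₁
  refine ⟨a, ?_⟩
  have h1 : (algebraMap (FixedPoints.subalgebra A B H) L)
        (algebraMap A (FixedPoints.subalgebra A B H) a) =
      e (algebraMap A (Localization.AtPrime (Q.under (FixedPoints.subalgebra A B H))) a) := by
    rw [IsScalarTower.algebraMap_apply A (FixedPoints.subalgebra A B H)
      (Localization.AtPrime (Q.under (FixedPoints.subalgebra A B H))), AlgEquiv.commutes]
  rw [h1, ← map_sub, ← IsLocalRing.map_ringEquiv_maximalIdeal e.toRingEquiv]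
  exact Ideal.mem_map_of_mem _ ha

/-- **Density for any localization `L` of `B^H` at `Q ∩ B^H`**: `A → L/𝔪_L^n` is onto for every
`n` ([CoP1] Prop. 9.3: "`R₁` lies dense in `R₁′`", for `R₁′` realised e.g. as a subring of the
ambient field). [cite: CossartPiltant2008, proof of Prop. 9.3 (HAL p. 28)] [cite: Abhyankar1959, Thm. 1.47] -/
theorem surjective_quotient_maximalIdeal_pow_comp_of_stabilizer_le (n : ℕ) :
    Function.Surjective ((Ideal.Quotient.mk (IsLocalRing.maximalIdeal L ^ n)).comp
      ((algebraMap (FixedPoints.subalgebra A B H) L).comp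
        (algebraMap A (FixedPoints.subalgebra A B H)))) :=
  surjective_quotient_maximalIdeal_pow_comp _
    (map_comp_eq_maximalIdeal_of_stabilizer_le H Q hH L)
    (fun b => exists_sub_algebraMap_comp_mem_maximalIdeal_of_stabilizer_le H Q hH L b) n

end AnyLocalization

end Literature.AlgebraicGeometry.Resolution
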